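import Mathlib
import Literature.Computability.AlgebraicComplexity.ABV17SingularLocusBound
import Literature.Computability.AlgebraicComplexity.AlperBogartVelascoLowOrder
import Literature.Computability.AlgebraicComplexity.GGIL22StrengthBounds
import Summits.ValiantsHypothesis.ValiantsHypothesis.Theorems.PolyaContinuedLaplaceRigidityTwoLineBilinear
import Summits.ValiantsHypothesis.ValiantsHypothesis.Theorems.PolyaContinuedLaplaceRigidityTwoLineCase
import Summits.ValiantsHypothesis.ValiantsHypothesis.Theorems.PolyaContinuedLaplaceRigidityTopPrimeRigidity
import Summits.ValiantsHypothesis.ValiantsHypothesis.Theses.PolyaContinued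
import HarnessLib

/-!
# `str₂(per₄) ≥ 5`: the support item `StrengthTwoPerFourGeFive` (stmt-ValiantsHypothesis-27571) holds

The route `ValiantsHypothesis/PolyaContinued` support item R (tenure g12 2026-08-28 11:21Z per director-valiant g13 R226):
the `4 × 4` permanent over `ℂ` is NOT a sum of FOUR products `p_k q_k` of homogeneous quadrics — the next rung of the
strength ladder above the closed `StrengthTwoPerFourGeFour` (stmt-27078, `≥ 4`) and below the GATED `StrengthTwoPerFour`
(stmt-25160, `= 6`).  Mathematics = val-idea-10 g3's line `Cruxes/CoverDecancellation/Lines/component_rigidity.lean`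
(v8.1, sorry-free end to end; critic val-idea-crit-3 g3), whose lever is COMPONENT RIGIDITY: the equality case
`2w = codim Sing(per₄) = 8` of Kumar's bound is rigid — Kumar's ideal `J = (p_k, q_k)` has `≤ 8` generators and contains
`singPermIdeal ℂ 4` (height `8`), so some minimal prime `Q ⊇ J` has height `≤ 8` (Krull), i.e. `Q` is the ideal of a
TOP-DIMENSIONAL component of `Sing(per₄)`; by TOP-PRIME RIGIDITY (`TopPrime.topPrimeRigidity`: Kirkup's classification of
the height-8 primes over the `3 × 3` sub-permanents — 17819-w1 g2's K-core T7/T8, types (L)/(X), zero line; port-4's torus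
stability; LEMMA B) either every quadric of `Q` lies in `(x_{row i ∪ col c})` — impossible, the transposition monomial of
`per₄` through `(i,c)` meets that set once (`TwoLine.perPoly_ne_sum_mul_of_mem_span_rowCol`) — or `Q` is a two-line ideal,
the case excluded by `TwoLine.twoLineCase_of_topPrimeRigidity` (bidegree-(1,1) projection + the `8 × 8` dichotomy at
crit-3's certified point).

* `strengthTwoPerFourGeFive_of_topPrimeRigidity` — the line's composition `strengthTwoPerFourGeFive_of`, Theorems-side and
  def-free: TOP-PRIME RIGIDITY ⇒ the route decl.
* ★★ `strengthTwoPerFourGeFive` — the item, UNCONDITIONAL (exact type of the route decl).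

HONEST FRAMING: a SUPPORT rung of route `PolyaContinued` («str₂(per₄) ≥ 5»); it is implied by the GATED item 25160 and
implies the closed 27078's shape; it does NOT bear on the HELD crux 17819 `CoverDecancellation` (calibrated ≥ summit), nor
on `CentralLaplaceRigidity`, nor on `VP ≠ VNP`, which is NOT proved.  Method ceiling of record: «≥ 5, not = 6».
Credits: val-idea-10 g3 (line, LEMMA B, composition), val-width-17819-w1 g2 (K-core T7/T8, (L)/(X), zero line, stub-C
architecture), val-port-4 g1 (torus stability), val-idea-crit-3 g3 (certified point), val-port-2 g1 (Theorems port, stub C).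
[cite: GesmundoGhosalIkenmeyerLysikov2022, Prop. 6] [cite: Kirkup2008, Thm 14 / Prop 11]
-/

set_option autoImplicit false

-- the mandated summit-side namespace repeats a component by design (single-problem summit)
set_option linter.dupNamespace false

noncomputable section

open MvPolynomial

namespace Summit.ValiantsHypothesis.ValiantsHypothesis.Theorems.PolyaContinuedLaplaceRigidity

namespace StrengthFive

open Literature.Computability.AlgebraicComplexity

/-- **The line's composition, Theorems-side**: TOP-PRIME RIGIDITY of `Sing(per₄)` (unfolded) implies the rung
`str₂(per₄) ≥ 5` (the route decl `StrengthTwoPerFourGeFive` by name).  Kumar's ideal `J = (p_k, q_k)` is proper with `≤ 8`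
generators and contains `singIdeal per₄ = singPermIdeal ℂ 4`; a minimal prime `Q ⊇ J` has height `≤ 8` (Krull,
`Ideal.height_le_card_of_mem_minimalPrimes_span_finset`); types (X)/(K) put every `p_k, q_k` in `(x_{row i ∪ col c})`,
contradicting `TwoLine.perPoly_ne_sum_mul_of_mem_span_rowCol`; type (L) is the two-line case, excluded by
`TwoLine.twoLineCase_of_topPrimeRigidity`. [cite: GesmundoGhosalIkenmeyerLysikov2022, Prop. 6] -/
theorem strengthTwoPerFourGeFive_of_topPrimeRigidity
    (hB : ∀ P : Ideal (MvPolynomial (Fin 4 × Fin 4) ℂ), P.IsPrime →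
      VonZurGathen.singPermIdeal ℂ 4 ≤ P → P.height ≤ 8 →
        (∃ i c : Fin 4, ∀ f ∈ P, f.IsHomogeneous 2 →
            f ∈ Ideal.span ((fun e => (X e : MvPolynomial (Fin 4 × Fin 4) ℂ)) ''
              ((Finset.univ.filter fun e : Fin 4 × Fin 4 => e.1 = i ∨ e.2 = c) : Set (Fin 4 × Fin 4)))) ∨
        (∃ i i' : Fin 4, i ≠ i' ∧
          (P = Ideal.span ((fun e => (X e : MvPolynomial (Fin 4 × Fin 4) ℂ)) ''
              ((Finset.univ.filter fun e : Fin 4 × Fin 4 => e.1 = i ∨ e.1 = i') : Set (Fin 4 × Fin 4))) ∨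
           P = Ideal.span ((fun e => (X e : MvPolynomial (Fin 4 × Fin 4) ℂ)) ''
              ((Finset.univ.filter fun e : Fin 4 × Fin 4 => e.2 = i ∨ e.2 = i') : Set (Fin 4 × Fin 4)))))) :
    Summit.ValiantsHypothesis.ValiantsHypothesis.Theses.PolyaContinued.StrengthTwoPerFourGeFive := by
  intro p q hpq
  obtain ⟨hp, hq, hf⟩ := hpq
  classical
  set S : Finset (MvPolynomial (Fin 4 × Fin 4) ℂ) := Finset.univ.image p ∪ Finset.univ.image q with hS
  set I : Ideal (MvPolynomial (Fin 4 × Fin 4) ℂ) := Ideal.span (S : Set _) with hI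
  have hpI : ∀ k, p k ∈ I := fun k => Ideal.subset_span (Finset.mem_coe.2
    (Finset.mem_union_left _ (Finset.mem_image_of_mem p (Finset.mem_univ k))))
  have hqI : ∀ k, q k ∈ I := fun k => Ideal.subset_span (Finset.mem_coe.2
    (Finset.mem_union_right _ (Finset.mem_image_of_mem q (Finset.mem_univ k))))
  have hScard : S.card ≤ 8 :=
    calc S.card ≤ (Finset.univ.image p).card + (Finset.univ.image q).card := Finset.card_union_le _ _
      _ ≤ (Finset.univ : Finset (Fin 4)).card + (Finset.univ : Finset (Fin 4)).card :=
          add_le_add Finset.card_image_le Finset.card_image_le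
      _ = 8 := by simp
  have hsing : singIdeal (perPoly (Fin 4) ℂ) ≤ I := GGIL22.singIdeal_le_of_eq_sum_mul p q hf I hpI hqI
  -- `I` is proper: all generators are homogeneous quadrics, hence constant-free
  have hIker : I ≤ RingHom.ker (constantCoeff : MvPolynomial (Fin 4 × Fin 4) ℂ →+* ℂ) := by
    rw [hI, Ideal.span_le]
    intro g hg
    rw [SetLike.mem_coe, RingHom.mem_ker]
    rw [Finset.mem_coe, hS, Finset.mem_union, Finset.mem_image, Finset.mem_image] at hg
    rcases hg with ⟨k, -, rfl⟩ | ⟨k, -, rfl⟩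
    · exact AlperBogartVelasco.constantCoeff_eq_zero_of_isHomogeneous (hp k) two_ne_zero
    · exact AlperBogartVelasco.constantCoeff_eq_zero_of_isHomogeneous (hq k) two_ne_zero
  have hItop : I ≠ ⊤ := fun htop => RingHom.ker_ne_top _ (top_le_iff.1 (htop ▸ hIker))
  obtain ⟨Q, hQ⟩ := Ideal.nonempty_minimalPrimes hItop
  have hQprime : Q.IsPrime := hQ.1.1
  have hIQ : I ≤ Q := hQ.1.2
  have hQ8 : Q.height ≤ 8 :=
    (Ideal.height_le_card_of_mem_minimalPrimes_span_finset hQ).trans (by exact_mod_cast hScard)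
  have hsingQ : VonZurGathen.singPermIdeal ℂ 4 ≤ Q := by
    rw [← singIdeal_perPoly]
    exact hsing.trans hIQ
  rcases hB Q hQprime hsingQ hQ8 with ⟨i, c, h1⟩ | ⟨i, i', hii', hP⟩
  · -- types (X) / (K): all quadrics of `Q` lie in `(x_{row i ∪ col c})`
    exact TwoLine.perPoly_ne_sum_mul_of_mem_span_rowCol i c p q
      (fun k => h1 _ (hIQ (hpI k)) (hp k)) (fun k => h1 _ (hIQ (hqI k)) (hq k)) hf
  · -- type (L): `Q` is the ideal of two parallel lines — the two-line case
    have hC := TwoLine.twoLineCase_of_topPrimeRigidity hB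
    rcases hP with hP | hP
    · exact hC i i' hii' _ (Or.inl rfl) p q (fun k => hP ▸ hIQ (hpI k))
        (fun k => hP ▸ hIQ (hqI k)) ⟨hp, hq, hf⟩
    · exact hC i i' hii' _ (Or.inr rfl) p q (fun k => hP ▸ hIQ (hpI k))
        (fun k => hP ▸ hIQ (hqI k)) ⟨hp, hq, hf⟩

/-- ★★ **Item stmt-ValiantsHypothesis-27571 `StrengthTwoPerFourGeFive` — proved** (exact type of the route decl):
`str₂(per₄) ≥ 5`, i.e. the `4 × 4` permanent over `ℂ` is not a sum of four products of homogeneous quadrics.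
TOP-PRIME RIGIDITY (`TopPrime.topPrimeRigidity`) + the composition above.
[cite: Kirkup2008, Thm 14 / Prop 11] [cite: GesmundoGhosalIkenmeyerLysikov2022, Prop. 6] -/
theorem strengthTwoPerFourGeFive :
    Summit.ValiantsHypothesis.ValiantsHypothesis.Theses.PolyaContinued.StrengthTwoPerFourGeFive :=
  strengthTwoPerFourGeFive_of_topPrimeRigidity TopPrime.topPrimeRigidity

end StrengthFive

end Summit.ValiantsHypothesis.ValiantsHypothesis.Theorems.PolyaContinuedLaplaceRigidity

end
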